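import Summits.SmoothPoincare4.SmoothPoincare4.Theorems.SullivanDualHyperbolicEndStubNearSymplecticData
import Literature.Geometry.Symplectic.NearSymplecticTwoCirclesReductionStrict

/-!
# Route `SullivanDual`, crux `HyperbolicEnd` (stmt-SmoothPoincare4-7825), line `taubes-circle-pencil`:
# stub S1 `stub_nearSymplecticData` staged on (G') Gerig + (H') Honda via the strict reduction

Stub S1 of the checked skeleton `Cruxes/HyperbolicEnd/Lines/taubes_circle_pencil.lean` asks, for every
homotopy 4-sphere `Σ` and `p ∈ Σ`, for relative near-symplectic data
`IsNearSymplecticData p ε δ sf Ψ₁ Ψ₂` (`Theorems/SullivanDualHyperbolicEndTaubesModelDefs.lean`).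
`Theorems/SullivanDualHyperbolicEndStubNearSymplecticData.lean` stages it on the Literature named fact
`Literature.Geometry.Symplectic.relNearSymplecticTaubesTubes_exists`
(`helper_nearSymplecticData_of_relNearSymplecticTaubesTubes`), and
`Literature/Geometry/Symplectic/NearSymplecticTwoCirclesReductionStrict.lean` PROVES that named fact
from exactly two published inputs, both phrased for STRICTLY near-symplectic forms:

* (G') for every homotopy `4`-sphere `Σ` and `p ∈ Σ`: an orientation of `Σ ∖ p`, a strictly
  near-symplectic `2`-form on `Σ ∖ p` standard on a punctured chart-ball, and two even zero circles
  with disjoint ranges exhausting its zero locus — Gerig, AGT 21 (2021), Thm. 1.6 with §3 (first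
  par., `N = 2`), via Perutz, JSG 4 (2006), Thm. 1.4 / 1.8 and Lemma 2.1 (a);
* (H') Honda's normal form along an even zero circle of a strictly near-symplectic form, realised by
  a deformation supported in any prescribed open neighbourhood of the circle, keeping the zero locus
  — Honda, Crelle 577 (2004), §4 Thm. 5 with Thm. 4 (A); Perutz 2006, Lemma 3.1 with its footnote.

This file records S1's exact residual dependency as the STAGING theorem (registered helper)
`helper_nearSymplecticData_of_twoEvenCircles_of_hondaNormalForm`: (G') → (H') → the statement of
`stub_nearSymplecticData` verbatim.  The proof is pure composition of the two landed theorems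
(`relNearSymplecticTaubesTubes_exists_of_twoEvenCircles_of_hondaNormalForm_strict`, then
`helper_nearSymplecticData_of_relNearSymplecticTaubesTubes`); the hypotheses are the Literature
theorem's hypotheses verbatim (its local notation `E4` spelled out as `EuclideanSpace ℝ (Fin 4)`).
The stub itself stays open modulo (G') and (H') (a stub cannot be closed conditionally).
-/

-- the registered namespace `Summit.SmoothPoincare4.SmoothPoincare4.…` repeats a component (P = Sub)
set_option linter.dupNamespace false

noncomputable section

open scoped Manifold ContDiff Topology
open Set Literature.Geometry.Kaehler Literature.Geometry.Symplectic Literature.Topology.FourManifolds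

namespace Summit.SmoothPoincare4.SmoothPoincare4.Cruxes.HyperbolicEnd.TaubesCirclePencil

-- registered signature, verbatim on one line (gate matches name + header textually)
/-- **Stub S1 modulo (G') and (H').**  If
(G') for every homotopy `4`-sphere `Σ` and `p ∈ Σ` there are `ε > 0` with
`closedBall (e p) ε ⊆ e.target`, an orientation `o` of `Σ ∖ p`, a strictly `o`-near-symplectic
`2`-form `sf` on `Σ ∖ p` standard on the punctured `ε`-chart-ball, and two even zero circles
`γ₁, γ₂` of `sf` with disjoint ranges exhausting the zero locus of `sf`
[cite: Gerig2021NoHomotopySphereInvariants, Thm 1.6]; and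
(H') on every punctured homotopy `4`-sphere, every strictly `o`-near-symplectic form `sf` with an
even zero circle `γ` can be replaced, inside any open `N ⊇ γ(ℝ)`, by a strictly
`o`-near-symplectic form `sf'` with `sf' = sf` off `N`, the same zero locus, and a Honda model
chart of some radius `r > 0` inside `N` whose axis image is `γ(ℝ)` [cite: Honda2004LocalSD, Thm 5]
[cite: Perutz2006, Lemma 3.1];
then the statement of `stub_nearSymplecticData` holds VERBATIM: for every homotopy 4-sphere `Σ` and
`p ∈ Σ` there are `ε, δ, sf, Ψ₁, Ψ₂` with `IsNearSymplecticData p ε δ sf Ψ₁ Ψ₂`.  Composition of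
`relNearSymplecticTaubesTubes_exists_of_twoEvenCircles_of_hondaNormalForm_strict` (the named fact
`relNearSymplecticTaubesTubes_exists` from (G') and (H')) with
`helper_nearSymplecticData_of_relNearSymplecticTaubesTubes` (the named fact implies the stub). -/
theorem helper_nearSymplecticData_of_twoEvenCircles_of_hondaNormalForm : (∀ (S : Literature.Topology.FourManifolds.HomotopySphere 4) (p : S.carrier), ∃ (ε : ℝ) (o : SmoothOrientation (𝓡 4) (punctured p)) (sf : MForm (𝓡 4) (punctured p) ℝ 2) (γ₁ γ₂ : ℝ → punctured p), 0 < ε ∧ Metric.closedBall (extChartAt (𝓡 4) p p) ε ⊆ (extChartAt (𝓡 4) p).target ∧ IsStrictlyNearSymplectic o sf ∧ IsStandardOnBall p ε sf ∧ IsEvenZeroCircle sf γ₁ ∧ IsEvenZeroCircle sf γ₂ ∧ Disjoint (range γ₁) (range γ₂) ∧ zeroLocus sf = range γ₁ ∪ range γ₂) → (∀ (S : Literature.Topology.FourManifolds.HomotopySphere 4) (p : S.carrier) (o : SmoothOrientation (𝓡 4) (punctured p)) (sf : MForm (𝓡 4) (punctured p) ℝ 2) (γ : ℝ → punctured p) (N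 : Set (punctured p)), IsStrictlyNearSymplectic o sf → IsEvenZeroCircle sf γ → IsOpen N → range γ ⊆ N → ∃ (sf' : MForm (𝓡 4) (punctured p) ℝ 2) (r : ℝ) (χ : EuclideanSpace ℝ (Fin 4) → punctured p), IsStrictlyNearSymplectic o sf' ∧ (∀ x : punctured p, x ∉ N → sf' x = sf x) ∧ zeroLocus sf' = zeroLocus sf ∧ 0 < r ∧ IsHondaModelChartIn N r sf' χ ∧ χ '' hondaAxis = range γ) → ∀ (S : HomotopySphere 4) (p : S.carrier), ∃ (ε δ : ℝ) (sf : MForm (𝓡 4) ↥(punctured p) ℝ 2) (Ψ₁ Ψ₂ : EuclideanSpace ℝ (Fin 4) → ↥(punctured p)), IsNearSymplecticData p ε δ sf Ψ₁ Ψ₂ :=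
  fun hG hH => helper_nearSymplecticData_of_relNearSymplecticTaubesTubes
    (relNearSymplecticTaubesTubes_exists_of_twoEvenCircles_of_hondaNormalForm_strict hG hH)

end Summit.SmoothPoincare4.SmoothPoincare4.Cruxes.HyperbolicEnd.TaubesCirclePencil

end
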